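import Literature.Computability.Cryptography.LWERoundingApprox
import Literature.Computability.Cryptography.StatisticalDistanceMapProofs
import Literature.Probability.Distributions.IndepProductLawDistance
import HarnessLib

/-!
# Rounding a jittered Gaussian at finite precision, II: the two bridges (ideal side = `roundLaw`, machine side = coins)

Topic `Computability/Cryptography` (LWE), grouping namespace `BLPRS2013`; sequel of `LWERoundingApprox.lean`, which
bounds `Δ(machRoundLaw, idealRoundLaw)` for the two COUPLED rounded values `⌊c + q'u/Q + κg⌉` and
`⌊c + q'û/Q + κ̂·round(2ᵇg)/2ᵇ⌉` of the base pair `(u, g) ← U[-½,½) ⊗ 𝒩(0,½)`. Here the two ends are identified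
with what they stand for (everything PROVED, definitions with bodies, no named fact):

* **ideal side** — `contNoise_eq_map_baseUG` (`(u, w)`, `w ← D_σ`, is `(u, (σ/√π)·g)`), hence
  **`roundLaw_eq_idealRoundLaw_map`**: the law `roundLaw c σ` of the continuous ingredient of the sampling form
  (`LWESwitchSamplingForm.lean`) is `idealRoundLaw c κ mod q'` with `κ = q'σ/√π`;
* **machine side** — `machValue k G = ⌊c + q'((k+½)/2ᴾ - ½)/Q + κ̂G/2ᵇ⌉` (what the program computes, in exact
  rational arithmetic, from the cell index `k < 2ᴾ` read off `P` coins and the integer `G` returned by an integer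
  sampler), `coinRoundLaw c κ̂ b P ℓ` (its law when `k` is uniform and `G ← ℓ`), the dyadic cells `cell P k`
  (`gridMid` is the midpoint on a cell, the cells partition `[-½,½)`, each of length `2^{-P}`), and
  **`coinRoundLaw_gaussBoxPMF_eq`**: with the rounded Gaussian `ℓ = gaussBoxPMF b` (law of `round(2ᵇg)`) the coin
  law IS `machRoundLaw` (disintegrate `baseUG` along `u`, split `[-½,½)` into the `2ᴾ` cells);
* **assembly** — `tvDist_coinRoundLaw_le` (data processing in `ℓ`), **`tvDist_coinRoundLaw_idealRoundLaw_le`**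
  (`≤ Δ(ℓ, gaussBoxPMF b) + (s+4)(2/s)(δ₀ + (3/2)δ₁)`), its instance **`tvDist_coinRoundLaw_std_le`** for the tree's
  pseudo-Gaussian sampler `PGParams.std m b` (`Δ(ℓ, gaussBoxPMF b) ≤ 8·2^{-m}`,
  `PseudoGaussianSamplerParams.lean`), and the `mod q'` form **`tvDist_coinRoundLaw_map_roundLaw_le`** against
  `roundLaw c σ` itself.

## References

* Z. Brakerski, A. Langlois, C. Peikert, O. Regev, D. Stehlé, *Classical hardness of learning with errors*, STOC 2013;
  arXiv:1306.0281, Lemma 2.3 / §5 (efficient sampling to within negligible distance) and Cor. 3.2. [BrakerskiEtAl2013]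
* C. Peikert, *Public-key cryptosystems from the worst-case shortest vector problem*, STOC 2009, full version p. 7
  ("we can efficiently sample … to within a suitable amount of precision"). [Peikert2009]
* O. Goldreich, *Foundations of Cryptography I*, CUP 2001, §3.2.1–§3.2.2 (statistical distance, data processing).
  [Goldreich2001]
-/

noncomputable section

open MeasureTheory ProbabilityTheory Literature.Probability.Distributions
open scoped Real ENNReal NNReal

namespace Literature.Computability.Cryptography

namespace BLPRS2013

/-! ### The ideal side is `roundLaw` -/

section Ideal

variable (Q q' : ℕ) [NeZero q']

/-- **`(u, w) ≐ (u, (σ/√π)g)`**: the continuous noise of one switched sample is the image of the base pair.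
[cite: BrakerskiEtAl2013, §2.2 (`D_s` has density `s⁻¹e^{-π(x/s)²}`, i.e. variance `s²/2π`)] -/
theorem contNoise_eq_map_baseUG (σ : ℝ) :
    contNoise σ = baseUG.map (Prod.map id (fun g : ℝ => σ / √π * g)) := by
  rw [baseUG, ← Measure.map_prod_map _ _ measurable_id (measurable_const_mul _), Measure.map_id,
    gaussianReal_map_const_mul, mul_zero, contNoise]
  congr 2
  ext
  push_cast
  rw [Real.coe_toNNReal _ (by positivity), div_pow, Real.sq_sqrt Real.pi_pos.le]
  ring

/-- **The ideal rounded law mod `q'` is `roundLaw`**: `roundLaw c σ = idealRoundLaw c κ mod q'` with `κ = q'σ/√π`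
(`q'w ≐ κg`). [cite: BrakerskiEtAl2013, Cor. 3.2 (the rounding `⌊q'·⌉`)] -/
theorem roundLaw_eq_idealRoundLaw_map (c σ : ℝ) :
    roundLaw Q q' c σ = (idealRoundLaw Q q' c ((q' : ℝ) * σ / √π)).map (fun z : ℤ => (z : ZMod q')) := by
  apply PMF.toMeasure_injective
  rw [toMeasure_roundLaw, ← PMF.toMeasure_map _ _ measurable_from_top, idealRoundLaw, Measure.toPMF_toMeasure,
    Measure.map_map measurable_from_top (measurable_idealRound Q q' c _), contNoise_eq_map_baseUG,
    Measure.map_map (measurable_roundMap Q q' c) (measurable_id.prodMap (measurable_const_mul _))]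
  congr 1
  funext p
  simp only [Function.comp_apply, roundMap, idealRound, Prod.map_fst, Prod.map_snd, id_eq]
  rw [show (q' : ℝ) * (σ / √π * p.2) = (q' : ℝ) * σ / √π * p.2 by ring]

end Ideal

/-! ### The machine side: cell index and integer sampler -/

section Coins

variable (Q q' : ℕ)

/-- **What the program computes**: `⌊c + q'·((k+½)/2ᴾ - ½)/Q + κ̂·G/2ᵇ⌉` from the cell index `k` and the sampler's
integer `G` (exact rational arithmetic when `c, κ̂ ∈ ℚ`). [cite: Peikert2009, p. 7 ("a suitable amount of precision")] -/
def machValue (c κh : ℝ) (b P : ℕ) (k : ℕ) (G : ℤ) : ℤ :=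
  round (c + (q' : ℝ) * (((k : ℝ) + 1 / 2) / 2 ^ P - 1 / 2) / Q + κh * (G : ℝ) / 2 ^ b)

/-- **The coin-driven rounded law**: `k` uniform on `[0, 2ᴾ)` (`P` fair coins), `G ← ℓ` (an integer sampler),
output `machValue k G`. [cite: Peikert2009, p. 7] -/
def coinRoundLaw (c κh : ℝ) (b P : ℕ) (ℓ : PMF ℤ) : PMF ℤ :=
  (PMF.uniformOfFintype (Fin (2 ^ P))).bind fun k => ℓ.map (machValue Q q' c κh b P k)

/-- **The dyadic cells** of `[-½,½)`: `cell P k = [k/2ᴾ - ½, (k+1)/2ᴾ - ½)`. [folklore] -/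
def cell (P k : ℕ) : Set ℝ := Set.Ico ((k : ℝ) / 2 ^ P - 1 / 2) (((k : ℝ) + 1) / 2 ^ P - 1 / 2)

/-- Cells are measurable. [folklore] -/
theorem measurableSet_cell (P k : ℕ) : MeasurableSet (cell P k) := measurableSet_Ico

/-- A cell has length `2^{-P}`. [folklore] -/
theorem volume_cell (P k : ℕ) : volume (cell P k) = ENNReal.ofReal (1 / 2 ^ P) := by
  rw [cell, Real.volume_Ico]
  congr 1
  ring

/-- **On a cell the jitter's midpoint is the cell's midpoint.** [folklore] -/
theorem gridMid_eq_of_mem_cell {P k : ℕ} {u : ℝ} (hu : u ∈ cell P k) :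
    gridMid P u = ((k : ℝ) + 1 / 2) / 2 ^ P - 1 / 2 := by
  have h2 : (0 : ℝ) < 2 ^ P := by positivity
  obtain ⟨h1, h1'⟩ := hu
  have hlo : (k : ℝ) ≤ (2 : ℝ) ^ P * (u + 1 / 2) := by
    have : (k : ℝ) / 2 ^ P ≤ u + 1 / 2 := by linarith
    rw [div_le_iff₀ h2] at this
    linarith
  have hhi : (2 : ℝ) ^ P * (u + 1 / 2) < (k : ℝ) + 1 := by
    have : u + 1 / 2 < ((k : ℝ) + 1) / 2 ^ P := by linarith
    rw [lt_div_iff₀ h2] at this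
    linarith
  have hfl : ⌊(2 : ℝ) ^ P * (u + 1 / 2)⌋ = (k : ℤ) := by
    rw [Int.floor_eq_iff]
    push_cast
    exact ⟨hlo, hhi⟩
  rw [gridMid, hfl]
  push_cast
  ring

/-- **On a cell the machine's rounded value is `machValue` of the cell index.** [folklore] -/
theorem machRound_eq_machValue {P k : ℕ} {u : ℝ} (hu : u ∈ cell P k) (c κh : ℝ) (b : ℕ) (g : ℝ) :
    machRound Q q' c κh b P (u, g) = machValue Q q' c κh b P k (round ((2 : ℝ) ^ b * g)) := by
  rw [machRound, machValue, gridMid_eq_of_mem_cell hu]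

/-- **The cells partition the jitter's range.** [folklore] -/
theorem biUnion_cell (P : ℕ) : (⋃ k ∈ Finset.range (2 ^ P), cell P k) = Set.Ico (-(1 / 2 : ℝ)) (1 / 2) := by
  have h2 : (0 : ℝ) < 2 ^ P := by positivity
  ext u
  simp only [Set.mem_iUnion, Finset.mem_range, exists_prop, Set.mem_Ico]
  constructor
  · rintro ⟨k, hk, h1, h1'⟩
    have hk' : (k : ℝ) + 1 ≤ 2 ^ P := by exact_mod_cast hk
    constructor
    · have : (0 : ℝ) ≤ (k : ℝ) / 2 ^ P := by positivity
      linarith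
    · have : ((k : ℝ) + 1) / 2 ^ P ≤ 1 := by rwa [div_le_one h2]
      linarith
  · rintro ⟨h1, h1'⟩
    have ha0 : (0 : ℝ) ≤ (2 : ℝ) ^ P * (u + 1 / 2) := by nlinarith
    obtain ⟨k, hk⟩ := Int.eq_ofNat_of_zero_le (Int.floor_nonneg.2 ha0)
    have hfl := Int.floor_le ((2 : ℝ) ^ P * (u + 1 / 2))
    have hlt := Int.lt_floor_add_one ((2 : ℝ) ^ P * (u + 1 / 2))
    rw [hk] at hfl hlt
    push_cast at hfl hlt
    refine ⟨k, ?_, ?_, ?_⟩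
    · have hlt2 : (2 : ℝ) ^ P * (u + 1 / 2) < 2 ^ P := by nlinarith
      have : (k : ℝ) < 2 ^ P := hfl.trans_lt hlt2
      exact_mod_cast this
    · have : (k : ℝ) / 2 ^ P ≤ u + 1 / 2 := by rw [div_le_iff₀ h2]; linarith
      linarith
    · have : u + 1 / 2 < ((k : ℝ) + 1) / 2 ^ P := by rw [lt_div_iff₀ h2]; linarith
      linarith

/-- The cells are pairwise disjoint. [folklore] -/
theorem pairwiseDisjoint_cell (P : ℕ) (s : Set ℕ) : s.PairwiseDisjoint (cell P) := by
  intro k _ k' _ hne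
  change Disjoint (cell P k) (cell P k')
  refine Set.disjoint_left.2 fun u hu hu' => hne ?_
  obtain ⟨h1, h2⟩ := hu
  obtain ⟨h1', h2'⟩ := hu'
  have hP : (0 : ℝ) < 2 ^ P := by positivity
  have a1 : (k : ℝ) / 2 ^ P < ((k' : ℝ) + 1) / 2 ^ P := by linarith
  have a2 : (k' : ℝ) / 2 ^ P < ((k : ℝ) + 1) / 2 ^ P := by linarith
  rw [div_lt_div_iff_of_pos_right hP] at a1 a2
  have b1 : k < k' + 1 := by exact_mod_cast a1
  have b2 : k' < k + 1 := by exact_mod_cast a2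
  omega

/-- **The coin law with the rounded Gaussian IS the machine's rounded law**: with `ℓ = gaussBoxPMF b` (the law of
`round(2ᵇg)`, `g ← 𝒩(0,½)`) and `k` uniform, `coinRoundLaw = machRoundLaw` — disintegrate the base pair along the
jitter and split `[-½,½)` into its `2ᴾ` cells, on each of which the machine's value is `machValue k (round(2ᵇg))`.
[cite: Peikert2009, p. 7; Goldreich2001, §3.2.1] -/
theorem coinRoundLaw_gaussBoxPMF_eq (c κh : ℝ) (b P : ℕ) :
    coinRoundLaw Q q' c κh b P (gaussBoxPMF b) = machRoundLaw Q q' c κh b P := by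
  apply PMF.toMeasure_injective
  refine Measure.ext fun S hS => ?_
  -- the coin side
  have hL : (coinRoundLaw Q q' c κh b P (gaussBoxPMF b)).toMeasure S =
      ∑ k ∈ Finset.range (2 ^ P), (2 ^ P : ℝ≥0∞)⁻¹ * gaussBoxMeasure b (machValue Q q' c κh b P k ⁻¹' S) := by
    rw [coinRoundLaw, PMF.toMeasure_bind_apply _ _ _ hS, tsum_fintype,
      ← Fin.sum_univ_eq_sum_range (fun k => (2 ^ P : ℝ≥0∞)⁻¹ * gaussBoxMeasure b (machValue Q q' c κh b P k ⁻¹' S))]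
    refine Finset.sum_congr rfl fun k _ => ?_
    rw [PMF.uniformOfFintype_apply, Fintype.card_fin, PMF.toMeasure_map_apply _ _ _ measurable_from_top hS,
      gaussBoxPMF, Measure.toPMF_toMeasure]
    push_cast
    rfl
  -- the measure side: disintegrate along `u`, split into cells
  have hE : MeasurableSet (machRound Q q' c κh b P ⁻¹' S) := measurable_machRound Q q' c κh b P hS
  have hR : (machRoundLaw Q q' c κh b P).toMeasure S =
      ∑ k ∈ Finset.range (2 ^ P), ∫⁻ u in cell P k,
        gaussianReal 0 (1 / 2 : ℝ≥0) (Prod.mk u ⁻¹' (machRound Q q' c κh b P ⁻¹' S)) ∂volume := by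
    rw [machRoundLaw, Measure.toPMF_toMeasure, Measure.map_apply (measurable_machRound Q q' c κh b P) hS, baseUG,
      Measure.prod_apply hE, LWE.unitUniform, ← biUnion_cell P,
      lintegral_biUnion_finset (pairwiseDisjoint_cell P _) (fun k _ => measurableSet_cell P k)]
  have hcellInt : ∀ k ∈ Finset.range (2 ^ P),
      ∫⁻ u in cell P k, gaussianReal 0 (1 / 2 : ℝ≥0) (Prod.mk u ⁻¹' (machRound Q q' c κh b P ⁻¹' S)) ∂volume =
        (2 ^ P : ℝ≥0∞)⁻¹ * gaussBoxMeasure b (machValue Q q' c κh b P k ⁻¹' S) := by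
    intro k _hk
    have hconst : Set.EqOn (fun u => gaussianReal 0 (1 / 2 : ℝ≥0) (Prod.mk u ⁻¹' (machRound Q q' c κh b P ⁻¹' S)))
        (fun _ => gaussBoxMeasure b (machValue Q q' c κh b P k ⁻¹' S)) (cell P k) := by
      intro u hu
      simp only
      have hset : Prod.mk u ⁻¹' (machRound Q q' c κh b P ⁻¹' S) =
          (fun x : ℝ => round ((2 : ℝ) ^ b * x)) ⁻¹' (machValue Q q' c κh b P k ⁻¹' S) := by
        ext g
        simp only [Set.mem_preimage]
        rw [machRound_eq_machValue Q q' hu]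
      rw [gaussBoxMeasure, Measure.map_apply (measurable_round_two_pow_mul b) (MeasurableSet.of_discrete), hset]
    rw [setLIntegral_congr_fun (measurableSet_cell P k) hconst, setLIntegral_const, volume_cell, mul_comm]
    congr 1
    rw [one_div, ENNReal.ofReal_inv_of_pos (by positivity), ENNReal.ofReal_pow (by norm_num)]
    norm_num
  rw [hL, hR]
  exact (Finset.sum_congr rfl hcellInt).symm

/-- **Data processing in the sampler**: `Δ(coinRoundLaw ℓ, coinRoundLaw ℓ') ≤ Δ(ℓ, ℓ')`. [cite: Goldreich2001, §3.2.2] -/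
theorem tvDist_coinRoundLaw_le (c κh : ℝ) (b P : ℕ) (ℓ ℓ' : PMF ℤ) :
    (coinRoundLaw Q q' c κh b P ℓ).tvDist (coinRoundLaw Q q' c κh b P ℓ') ≤ ℓ.tvDist ℓ' :=
  PMF.tvDist_bind_le_of_forall_le _ _ _ fun _ => PMF.tvDist_map_le_holds _ _ _

variable [NeZero Q] [NeZero q']

/-- **The coin law is close to the ideal rounded law**:
`Δ(coinRoundLaw ℓ, idealRoundLaw) ≤ Δ(ℓ, gaussBoxPMF b) + (s+4)(2/s)(δ₀ + (3/2)δ₁)`, `s = q'/Q`,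
`δ₀ = s·2^{-(P+1)} + |κ̂|·2^{-(b+1)}`, `δ₁ = |κ̂ - κ|`. [cite: Peikert2009, p. 7; Goldreich2001, §3.2.1] -/
theorem tvDist_coinRoundLaw_idealRoundLaw_le (c κ κh : ℝ) (b P : ℕ) (ℓ : PMF ℤ) :
    (coinRoundLaw Q q' c κh b P ℓ).tvDist (idealRoundLaw Q q' c κ) ≤
      ℓ.tvDist (gaussBoxPMF b) + ((q' : ℝ) / Q + 4) * (2 / ((q' : ℝ) / Q)) *
        (((q' : ℝ) / Q * (1 / 2 ^ (P + 1)) + |κh| * (1 / 2 ^ (b + 1))) + 3 / 2 * |κh - κ|) := by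
  refine (PMF.tvDist_triangle_holds _ (coinRoundLaw Q q' c κh b P (gaussBoxPMF b)) _).trans (add_le_add ?_ ?_)
  · exact tvDist_coinRoundLaw_le Q q' c κh b P ℓ (gaussBoxPMF b)
  · rw [coinRoundLaw_gaussBoxPMF_eq]
    exact tvDist_machRoundLaw_idealRoundLaw_le Q q' c κ κh b P

/-- **With the tree's pseudo-Gaussian sampler** (`PGParams.std m b`, `1 ≤ m`, `m + rOf m + 1 ≤ b`):
`Δ(coinRoundLaw ℓ', idealRoundLaw) ≤ 8·2^{-m} + (s+4)(2/s)(δ₀ + (3/2)δ₁)`. [cite: Peikert2009, p. 7] -/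
theorem tvDist_coinRoundLaw_std_le (c κ κh : ℝ) {m b : ℕ} (P : ℕ) (hm : 1 ≤ m) (hb : m + PGParams.rOf m + 1 ≤ b) :
    (coinRoundLaw Q q' c κh b P (PGParams.std m b).lawPMF).tvDist (idealRoundLaw Q q' c κ) ≤
      8 * ((2 : ℝ) ^ m)⁻¹ + ((q' : ℝ) / Q + 4) * (2 / ((q' : ℝ) / Q)) *
        (((q' : ℝ) / Q * (1 / 2 ^ (P + 1)) + |κh| * (1 / 2 ^ (b + 1))) + 3 / 2 * |κh - κ|) :=
  (tvDist_coinRoundLaw_idealRoundLaw_le Q q' c κ κh b P _).trans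
    (add_le_add (PGParams.tvDist_lawPMF_std_gaussBoxPMF_le m b hm hb) le_rfl)

/-- **Against `roundLaw` itself** (`mod q'`, `κ = q'σ/√π`):
`Δ(coinRoundLaw ℓ mod q', roundLaw c σ) ≤ Δ(ℓ, gaussBoxPMF b) + (s+4)(2/s)(δ₀ + (3/2)|κ̂ - q'σ/√π|)`.
[cite: BrakerskiEtAl2013, Cor. 3.2 with Lemma 2.3; Peikert2009, p. 7] -/
theorem tvDist_coinRoundLaw_map_roundLaw_le (c σ κh : ℝ) (b P : ℕ) (ℓ : PMF ℤ) :
    ((coinRoundLaw Q q' c κh b P ℓ).map (fun z : ℤ => (z : ZMod q'))).tvDist (roundLaw Q q' c σ) ≤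
      ℓ.tvDist (gaussBoxPMF b) + ((q' : ℝ) / Q + 4) * (2 / ((q' : ℝ) / Q)) *
        (((q' : ℝ) / Q * (1 / 2 ^ (P + 1)) + |κh| * (1 / 2 ^ (b + 1))) + 3 / 2 * |κh - (q' : ℝ) * σ / √π|) := by
  rw [roundLaw_eq_idealRoundLaw_map]
  exact (PMF.tvDist_map_le_holds _ _ _).trans (tvDist_coinRoundLaw_idealRoundLaw_le Q q' c _ κh b P ℓ)

end Coins

end BLPRS2013

end Literature.Computability.Cryptography

end
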